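import Summits.AnomalousDissipation.AnomalousDissipation.Theorems.SawtoothPulseCascadeK1LocalisedCascadeTraceKernels
import Summits.AnomalousDissipation.AnomalousDissipation.Theorems.SawtoothPulseCascadeK1LocalisedCascadeTraceSymmetry

/-!
# K1loc, line `Spectral` — helper: THE SYMMETRIC BOX-PRODUCT TRAPEZOID AS A CT MULTIPLIER (S-D, arbiter A24-3 (4))

The multiplier `χ_l = N(l)/R`, `N(l) = #{(j,j′) ∈ [−L, L+R) × [0, R) : j − j′ = l}` of `…TraceKernels` (plateau `|l| ≤ L`,
ramps of length `R`) in the shape the CT blocks `…ClassStepCTS.sum_window_iterate_{v,h}step_ct_split_le` consume: supported in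
`[−(L+R), L+R]`, real-valued in `[0,1]`, `= 1` on `|l| ≤ L`, EVEN; the source sum over `[−(L+R), L+R]` equals the sum over the
open interval of `…TraceKernels`; hence the sign-split trace scalars `Θ⁺ = Θ⁻ = ((√((2L+R)R)/R)·B)²/2` for a real input bounded
by `B` on a sign-symmetric fibre set (V and H indexing).
-/

-- `Summit.<Summit>.<Problem>`: single-conjunct summit, the duplicate namespace segment is deliberate.
set_option linter.dupNamespace false

namespace Summit.AnomalousDissipation.AnomalousDissipation.Theorems.SawtoothPulseCascade.K1Window

open MeasureTheory Set Filter Topology UnitAddTorus Function Complex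
open scoped Real ComplexConjugate

/-- The pair count of the symmetric box product `[−L, L+R) × [0, R)` at difference `l`. -/
private theorem boxCount_def (L R : ℕ) (l : ℤ) :
    (((Finset.Ico (-(L : ℤ)) (-(L : ℤ) + (2 * L + R : ℕ))) ×ˢ (Finset.Ico (0 : ℤ) R)).filter
      (fun p : ℤ × ℤ => p.1 - p.2 = l)).card ≤ R :=
  trapezoid_card_le _ _ _ _

/-- **Values in `[0,1]`**: `N(l)/R = r` with `0 ≤ r ≤ 1` real. [folklore] -/
theorem boxTrapezoid_real (L : ℕ) {R : ℕ} (hR : 0 < R) (l : ℤ) : ∃ r : ℝ, 0 ≤ r ∧ r ≤ 1 ∧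
    (((((Finset.Ico (-(L : ℤ)) (-(L : ℤ) + (2 * L + R : ℕ))) ×ˢ (Finset.Ico (0 : ℤ) R)).filter
      (fun p : ℤ × ℤ => p.1 - p.2 = l)).card : ℂ) / R) = (r : ℂ) := by
  have hRr : (0 : ℝ) < R := by exact_mod_cast hR
  refine ⟨((((Finset.Ico (-(L : ℤ)) (-(L : ℤ) + (2 * L + R : ℕ))) ×ˢ (Finset.Ico (0 : ℤ) R)).filter
      (fun p : ℤ × ℤ => p.1 - p.2 = l)).card : ℝ) / R, by positivity, ?_, by push_cast; rfl⟩
  rw [div_le_one hRr]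
  exact_mod_cast boxCount_def L R l

/-- **Real values** (weaker form used by `…TraceSymmetry`). [folklore] -/
theorem boxTrapezoid_real' (L R : ℕ) (l : ℤ) : ∃ r : ℝ,
    (((((Finset.Ico (-(L : ℤ)) (-(L : ℤ) + (2 * L + R : ℕ))) ×ˢ (Finset.Ico (0 : ℤ) R)).filter
      (fun p : ℤ × ℤ => p.1 - p.2 = l)).card : ℂ) / R) = (r : ℂ) :=
  ⟨((((Finset.Ico (-(L : ℤ)) (-(L : ℤ) + (2 * L + R : ℕ))) ×ˢ (Finset.Ico (0 : ℤ) R)).filter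
      (fun p : ℤ × ℤ => p.1 - p.2 = l)).card : ℝ) / R, by push_cast; rfl⟩

/-- **Support**: `N(l)/R = 0` off `[−(L+R), L+R]`. [folklore] -/
theorem boxTrapezoid_support (L R : ℕ) (l : ℤ) (hl : l ∉ Finset.Icc (-((L + R : ℕ) : ℤ)) (L + R : ℕ)) :
    (((((Finset.Ico (-(L : ℤ)) (-(L : ℤ) + (2 * L + R : ℕ))) ×ˢ (Finset.Ico (0 : ℤ) R)).filter
      (fun p : ℤ × ℤ => p.1 - p.2 = l)).card : ℂ) / R) = 0 := by
  rw [Finset.mem_Icc, not_and_or, not_le, not_le] at hl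
  rw [trapezoid_card_eq_zero _ _ _ (by push_cast; omega), Nat.cast_zero, zero_div]

/-- **Plateau**: `N(l)/R = 1` for `|l| ≤ L` (`R ≥ 1`). [folklore] -/
theorem boxTrapezoid_plateau (L : ℕ) {R : ℕ} (hR : 0 < R) (l : ℤ) (hl : |l| ≤ (L : ℤ)) :
    (((((Finset.Ico (-(L : ℤ)) (-(L : ℤ) + (2 * L + R : ℕ))) ×ˢ (Finset.Ico (0 : ℤ) R)).filter
      (fun p : ℤ × ℤ => p.1 - p.2 = l)).card : ℂ) / R) = 1 := by
  have hRc : (R : ℂ) ≠ 0 := by exact_mod_cast hR.ne'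
  obtain ⟨h1, h2⟩ := abs_le.mp hl
  rw [trapezoid_card_eq_of_plateau _ _ _ (by omega) (by push_cast; omega), div_self hRc]

/-- **Evenness**: `N(−l) = N(l)` for the symmetric box (the involution `(j,j′) ↦ (R−1−j, R−1−j′)`). [folklore] -/
theorem boxCount_neg (L R : ℕ) (l : ℤ) :
    (((Finset.Ico (-(L : ℤ)) (-(L : ℤ) + (2 * L + R : ℕ))) ×ˢ (Finset.Ico (0 : ℤ) R)).filter
        (fun p : ℤ × ℤ => p.1 - p.2 = -l)).card =
      (((Finset.Ico (-(L : ℤ)) (-(L : ℤ) + (2 * L + R : ℕ))) ×ˢ (Finset.Ico (0 : ℤ) R)).filter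
        (fun p : ℤ × ℤ => p.1 - p.2 = l)).card := by
  classical
  set Bx := (Finset.Ico (-(L : ℤ)) (-(L : ℤ) + (2 * L + R : ℕ))) ×ˢ (Finset.Ico (0 : ℤ) R) with hBx
  have hset : Bx.filter (fun p : ℤ × ℤ => p.1 - p.2 = -l) =
      (Bx.filter (fun p : ℤ × ℤ => p.1 - p.2 = l)).image (fun p : ℤ × ℤ => ((R : ℤ) - 1 - p.1, (R : ℤ) - 1 - p.2)) := by
    ext ⟨j, j'⟩
    simp only [hBx, Finset.mem_filter, Finset.mem_product, Finset.mem_Ico, Finset.mem_image, Prod.mk.injEq]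
    constructor
    · rintro ⟨⟨⟨hj1, hj2⟩, hj'1, hj'2⟩, hl⟩
      refine ⟨((R : ℤ) - 1 - j, (R : ℤ) - 1 - j'), ⟨⟨⟨?_, ?_⟩, ?_, ?_⟩, ?_⟩, ?_, ?_⟩ <;> push_cast at * <;> omega
    · rintro ⟨⟨q1, q2⟩, ⟨⟨⟨hq1, hq2⟩, hq3, hq4⟩, hq⟩, h1, h2⟩
      push_cast at *
      refine ⟨⟨⟨by omega, by omega⟩, by omega, by omega⟩, by omega⟩
  rw [hset, Finset.card_image_of_injOn]
  rintro ⟨p1, p2⟩ _ ⟨q1, q2⟩ _ h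
  simp only [Prod.mk.injEq] at h
  ext <;> simp only <;> omega

/-- **Evenness of the multiplier**: `N(−l)/R = N(l)/R`. [folklore] -/
theorem boxTrapezoid_even (L R : ℕ) (l : ℤ) :
    (((((Finset.Ico (-(L : ℤ)) (-(L : ℤ) + (2 * L + R : ℕ))) ×ˢ (Finset.Ico (0 : ℤ) R)).filter
      (fun p : ℤ × ℤ => p.1 - p.2 = -l)).card : ℂ) / R) =
    (((((Finset.Ico (-(L : ℤ)) (-(L : ℤ) + (2 * L + R : ℕ))) ×ˢ (Finset.Ico (0 : ℤ) R)).filter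
      (fun p : ℤ × ℤ => p.1 - p.2 = l)).card : ℂ) / R) := by
  rw [boxCount_neg]

/-- **The closed source interval**: a sum of `N(l)/R · g(l) · h(l)` over `[−(L+R), L+R]` equals the sum over the open
interval `(−L−R, −L+(2L+R))` of `…TraceKernels` (the endpoints carry `N = 0`). [folklore] -/
theorem sum_Icc_boxTrapezoid_eq_sum_Ioo (L R : ℕ) (g h : ℤ → ℂ) :
    ∑ l ∈ Finset.Icc (-((L + R : ℕ) : ℤ)) (L + R : ℕ),
      (((((Finset.Ico (-(L : ℤ)) (-(L : ℤ) + (2 * L + R : ℕ))) ×ˢ (Finset.Ico (0 : ℤ) R)).filter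
        (fun p : ℤ × ℤ => p.1 - p.2 = l)).card : ℂ) / R) * g l * h l =
    ∑ l ∈ Finset.Ioo (-(L : ℤ) - R) (-(L : ℤ) + (2 * L + R : ℕ)),
      (((((Finset.Ico (-(L : ℤ)) (-(L : ℤ) + (2 * L + R : ℕ))) ×ˢ (Finset.Ico (0 : ℤ) R)).filter
        (fun p : ℤ × ℤ => p.1 - p.2 = l)).card : ℂ) / R) * g l * h l := by
  symm
  refine Finset.sum_subset (fun l hl => ?_) (fun l _ hl => ?_)
  · rw [Finset.mem_Ioo] at hl; rw [Finset.mem_Icc]; push_cast at hl ⊢; omega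
  · rw [Finset.mem_Ioo, not_and_or, not_lt, not_lt] at hl
    rw [trapezoid_card_eq_zero _ _ _ (by push_cast at hl ⊢; omega), Nat.cast_zero, zero_div, zero_mul, zero_mul]

/-- **The trace scalar of the box trapezoid, V indexing**: for `b` integrable with `‖b‖ ≤ B` and any fibre set `F`,
`Σ_{n∈F} |Σ_{l∈[−(L+R),L+R]} (N(l)/R) 𝓕b(l,n) e^{2πily}|² ≤ (√((2L+R)R)/R · B)²`. [cite: Grafakos2014, Prop. 3.2.7 (3)] -/
theorem sum_sq_trace_boxTrapezoid_le_v {b : UnitAddTorus (Fin 2) → ℂ} (hb : Integrable b volume) {B : ℝ}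
    (hB : ∀ x, ‖b x‖ ≤ B) (L : ℕ) {R : ℕ} (hR : 0 < R) (F : Finset ℤ) (y : ℝ) :
    ∑ n ∈ F, ‖∑ l ∈ Finset.Icc (-((L + R : ℕ) : ℤ)) (L + R : ℕ),
      (((((Finset.Ico (-(L : ℤ)) (-(L : ℤ) + (2 * L + R : ℕ))) ×ˢ (Finset.Ico (0 : ℤ) R)).filter
        (fun p : ℤ × ℤ => p.1 - p.2 = l)).card : ℂ) / R) * mFourierCoeff b ![l, n] * cexp (2 * π * I * l * y)‖ ^ 2 ≤
      (Real.sqrt ((2 * L + R : ℕ) * R) / R * B) ^ 2 := by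
  have h := sum_sq_trace_trapezoid_le_vfibre hb hB (-(L : ℤ)) (A := 2 * L + R) (B := R) (by omega) hR F y
  refine le_of_eq_of_le (Finset.sum_congr rfl fun n _ => ?_) h
  exact congrArg (fun z : ℂ => ‖z‖ ^ 2) (sum_Icc_boxTrapezoid_eq_sum_Ioo L R (fun l => mFourierCoeff b ![l, n])
    (fun l => cexp (2 * π * I * l * y)))

/-- **The trace scalar of the box trapezoid, H indexing** (`𝓕b(n,l)`). [cite: Grafakos2014, Prop. 3.2.7 (3)] -/
theorem sum_sq_trace_boxTrapezoid_le_h {b : UnitAddTorus (Fin 2) → ℂ} (hb : Integrable b volume) {B : ℝ}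
    (hB : ∀ x, ‖b x‖ ≤ B) (L : ℕ) {R : ℕ} (hR : 0 < R) (F : Finset ℤ) (y : ℝ) :
    ∑ n ∈ F, ‖∑ l ∈ Finset.Icc (-((L + R : ℕ) : ℤ)) (L + R : ℕ),
      (((((Finset.Ico (-(L : ℤ)) (-(L : ℤ) + (2 * L + R : ℕ))) ×ˢ (Finset.Ico (0 : ℤ) R)).filter
        (fun p : ℤ × ℤ => p.1 - p.2 = l)).card : ℂ) / R) * mFourierCoeff b ![n, l] * cexp (2 * π * I * l * y)‖ ^ 2 ≤
      (Real.sqrt ((2 * L + R : ℕ) * R) / R * B) ^ 2 := by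
  have h := sum_sq_trace_trapezoid_le_hfibre hb hB (-(L : ℤ)) (A := 2 * L + R) (B := R) (by omega) hR F y
  refine le_of_eq_of_le (Finset.sum_congr rfl fun n _ => ?_) h
  exact congrArg (fun z : ℂ => ‖z‖ ^ 2) (sum_Icc_boxTrapezoid_eq_sum_Ioo L R (fun l => mFourierCoeff b ![n, l])
    (fun l => cexp (2 * π * I * l * y)))

/-- **The sign-split trace scalars of the box trapezoid for a REAL input, V indexing**: `‖v‖ ≤ B`, `v` continuous, `F`
sign-symmetric ⟹ both sign halves `≤ (√((2L+R)R)/R · B)²/2`. [cite: Grafakos2014, Prop. 3.2.7 (3)] -/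
theorem sum_sq_trace_boxTrapezoid_sign_le_v {v : UnitAddTorus (Fin 2) → ℝ} (hv : Continuous v) {B : ℝ}
    (hB : ∀ x, |v x| ≤ B) (L : ℕ) {R : ℕ} (hR : 0 < R) (F : Finset ℤ) (hF : ∀ n ∈ F, -n ∈ F) (y : ℝ) :
    ∑ n ∈ F.filter (fun n => 0 < n), ‖∑ l ∈ Finset.Icc (-((L + R : ℕ) : ℤ)) (L + R : ℕ),
      (((((Finset.Ico (-(L : ℤ)) (-(L : ℤ) + (2 * L + R : ℕ))) ×ˢ (Finset.Ico (0 : ℤ) R)).filter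
        (fun p : ℤ × ℤ => p.1 - p.2 = l)).card : ℂ) / R) * mFourierCoeff (fun x => (v x : ℂ)) ![l, n] *
          cexp (2 * π * I * l * y)‖ ^ 2 ≤ (Real.sqrt ((2 * L + R : ℕ) * R) / R * B) ^ 2 / 2 ∧
    ∑ n ∈ F.filter (fun n => n < 0), ‖∑ l ∈ Finset.Icc (-((L + R : ℕ) : ℤ)) (L + R : ℕ),
      (((((Finset.Ico (-(L : ℤ)) (-(L : ℤ) + (2 * L + R : ℕ))) ×ˢ (Finset.Ico (0 : ℤ) R)).filter
        (fun p : ℤ × ℤ => p.1 - p.2 = l)).card : ℂ) / R) * mFourierCoeff (fun x => (v x : ℂ)) ![l, n] *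
          cexp (2 * π * I * l * y)‖ ^ 2 ≤ (Real.sqrt ((2 * L + R : ℕ) * R) / R * B) ^ 2 / 2 := by
  have hvc : Continuous fun x => (v x : ℂ) := Complex.continuous_ofReal.comp hv
  have hB' : ∀ x, ‖(v x : ℂ)‖ ≤ B := fun x => by rw [Complex.norm_real, Real.norm_eq_abs]; exact hB x
  have hΘ := sum_sq_trace_boxTrapezoid_le_v (hvc.integrable_of_hasCompactSupport (HasCompactSupport.of_compactSpace _))
    hB' L hR F y
  exact sum_sq_trace_sign_le_half_v v (boxTrapezoid_real' L R) (boxTrapezoid_even L R) (L + R) F hF y hΘ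

/-- **The sign-split trace scalars of the box trapezoid for a REAL input, H indexing.** [cite: Grafakos2014, Prop. 3.2.7 (3)] -/
theorem sum_sq_trace_boxTrapezoid_sign_le_h {v : UnitAddTorus (Fin 2) → ℝ} (hv : Continuous v) {B : ℝ}
    (hB : ∀ x, |v x| ≤ B) (L : ℕ) {R : ℕ} (hR : 0 < R) (F : Finset ℤ) (hF : ∀ n ∈ F, -n ∈ F) (y : ℝ) :
    ∑ n ∈ F.filter (fun n => 0 < n), ‖∑ l ∈ Finset.Icc (-((L + R : ℕ) : ℤ)) (L + R : ℕ),
      (((((Finset.Ico (-(L : ℤ)) (-(L : ℤ) + (2 * L + R : ℕ))) ×ˢ (Finset.Ico (0 : ℤ) R)).filter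
        (fun p : ℤ × ℤ => p.1 - p.2 = l)).card : ℂ) / R) * mFourierCoeff (fun x => (v x : ℂ)) ![n, l] *
          cexp (2 * π * I * l * y)‖ ^ 2 ≤ (Real.sqrt ((2 * L + R : ℕ) * R) / R * B) ^ 2 / 2 ∧
    ∑ n ∈ F.filter (fun n => n < 0), ‖∑ l ∈ Finset.Icc (-((L + R : ℕ) : ℤ)) (L + R : ℕ),
      (((((Finset.Ico (-(L : ℤ)) (-(L : ℤ) + (2 * L + R : ℕ))) ×ˢ (Finset.Ico (0 : ℤ) R)).filter
        (fun p : ℤ × ℤ => p.1 - p.2 = l)).card : ℂ) / R) * mFourierCoeff (fun x => (v x : ℂ)) ![n, l] *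
          cexp (2 * π * I * l * y)‖ ^ 2 ≤ (Real.sqrt ((2 * L + R : ℕ) * R) / R * B) ^ 2 / 2 := by
  have hvc : Continuous fun x => (v x : ℂ) := Complex.continuous_ofReal.comp hv
  have hB' : ∀ x, ‖(v x : ℂ)‖ ≤ B := fun x => by rw [Complex.norm_real, Real.norm_eq_abs]; exact hB x
  have hΘ := sum_sq_trace_boxTrapezoid_le_h (hvc.integrable_of_hasCompactSupport (HasCompactSupport.of_compactSpace _))
    hB' L hR F y
  exact sum_sq_trace_sign_le_half_h v (boxTrapezoid_real' L R) (boxTrapezoid_even L R) (L + R) F hF y hΘ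

end Summit.AnomalousDissipation.AnomalousDissipation.Theorems.SawtoothPulseCascade.K1Window
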